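import Summits.BirchSwinnertonDyer.BirchSwinnertonDyer.Theses.ThetaPartnerAtTwo
import Summits.BirchSwinnertonDyer.BirchSwinnertonDyer.Theorems.ThetaPartnerAtTwoSignedMainConjectureCMTwoRankZeroPollackPairUnique
import Summits.BirchSwinnertonDyer.BirchSwinnertonDyer.Theorems.ThetaPartnerAtTwoSignedMainConjectureCMTwoRankZeroLengthDoors
import HarnessLib

/-! # Pen certificate (lead bsd-wall-tp2-p2 g7, 2026-08-28; v2 = g8 FREEZE, 2026-08-28T07Z: the three item texts of §1 are
BYTE-IDENTICAL to v1 (sha16 3ab245659885efad) — FLAT = the registered stub `stub_analyticMuFlatNonUnitCMTwo` verbatim; §2 (appended by g8)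
adds the K2r0P♭ closer from the LENGTH currency (MC-len)_A via the landed doors p609811/p610219 and records the print sources of D_MC's
port: Kato 2004 Astérisque 295 Prop. 15.9 + (15.6.4) + (15.12.2) + (15.16.1), Lemma 15.13 away from (2); Johnson-Leung–Kings 2011 Thm. 5.2;
Burungale–Flach 2024 Prop. 3.1 — cell memo ER2-PRINT-SOURCE-w2.md v1.1.)
# Pen certificate (lead bsd-wall-tp2-p2 g7, 2026-08-28): the μ-free twin K2r0P♭ of K2r0P (stmt-BirchSwinnertonDyer-24945) and its
two feeder texts, with kernel proofs that (i) D_MC (the Pollack–Rubin port at 2, two-sided, CONSTRUCTION form) ALONE closes K2r0P♭ and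
(ii) K2r0P♭ + FLAT give K2r0P VERBATIM (the split is lossless). For the pen of route ThetaPartnerAtTwo (census v9 §4 option (b)).
Nothing here is asserted; the three `def`s are PROPOSED item texts. BSD is not proved by any of this. -/

set_option autoImplicit false
set_option linter.dupNamespace false

noncomputable section

open scoped Classical NumberField MatrixGroups ModularForm

open NumberField IsDedekindDomain CongruenceSubgroup WeierstrassCurve Literature Literature.NumberTheory.EllipticCurves
  Literature.NumberTheory.GaloisRepresentations Literature.NumberTheory.EllipticCurves.ModularForms
  Literature.NumberTheory.EllipticCurves.Rank1Residual Literature.NumberTheory.EllipticCurves.IwasawaDual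
  Literature.NumberTheory.EllipticCurves.Kobayashi2003
  ZpExtension Summit.BirchSwinnertonDyer.Rank1Residual.Supersingular

namespace Summit.BirchSwinnertonDyer.BirchSwinnertonDyer.Cruxes.SignedMainConjectureCMTwoRankZeroOfPub.Cert

/-- PROPOSED ITEM TEXT D_MC («(MC±2^k)_A, two-sided, construction form»): for every rank-0 CM class member off the unit zone, every
normalised cyclotomic datum and the newform, there EXIST a period ratio `ϖ` and a Pollack pair at `2` with `char X⁺ = (g)`,
`2^{m'}·ι g = 2^m·ϖ·ι L♭` for every signed Selmer dual datum. (Research kernel (ER⁺@2); PR04-AT-TWO.md §5.) -/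
def SignedMainConjectureUpToTwoPowerCMTwoRankZero : Prop :=
  ∀ (A : WeierstrassCurve ℚ) [A.IsElliptic] [A.IsGloballyMinimal],
    A.HasCM → A.analyticRank = 0 → GoodSS A 2 → A.frobeniusTrace 2 = 0 →
    2 ∣ A.shaOrder * A.tamagawaProduct →
    ∀ (κ : ZpExtension ℚ 2) (γ : Field.absoluteGaloisGroup ℚ),
      κ.IsCyclotomic → κ.IsTopGenerator γ → IsCyclotomicVariable 2 γ →
    ∀ [NeZero (A.conductorNorm ℤ)] (f : CuspForm (Gamma0 (A.conductorNorm ℤ)) 2), IsNewformOf A f →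
    ∃ (ϖ : ℚ) (Lplus Lminus : IwasawaAlgebra 2), (ϖ : ℝ) * A.realPeriodRat = plusPeriod f ∧
      IsPollackPair f 2 Lplus Lminus ∧
      ∀ (D : SignedSelmerDualData A κ γ 1),
        ∃ (g : IwasawaAlgebra 2) (m m' : ℕ), D.charIdeal = Ideal.span {g} ∧
          PowerSeries.C ((2 : ℚ_[2]) ^ m') * iwasawaToPowerSeries 2 g =
            PowerSeries.C ((2 : ℚ_[2]) ^ m * (ϖ : ℚ_[2])) * iwasawaToPowerSeries 2 (kobayashiL 1 Lplus Lminus)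

/-- PROPOSED ITEM TEXT FLAT («(μ♭)_A», the registered stub `stub_analyticMuFlatNonUnitCMTwo` VERBATIM): off the unit zone, `L♭` of the
rank-0 CM class member has a unit coefficient for every Pollack pair at `2`. (Certificate-grade per residual class via (G′)_N;
open-problem grade class-wide.) -/
def AnalyticMuFlatCMTwoRankZero : Prop :=
  ∀ (A : WeierstrassCurve ℚ) [A.IsElliptic] [A.IsGloballyMinimal],
    A.HasCM → A.analyticRank = 0 → GoodSS A 2 → A.frobeniusTrace 2 = 0 →
    2 ∣ A.shaOrder * A.tamagawaProduct →
    ∀ [NeZero (A.conductorNorm ℤ)] (f : CuspForm (Gamma0 (A.conductorNorm ℤ)) 2),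
    IsNewformOf A f → ∀ (Lplus Lminus : IwasawaAlgebra 2), IsPollackPair f 2 Lplus Lminus →
      ∃ n : ℕ, IsUnit (PowerSeries.coeff n (kobayashiL 1 Lplus Lminus))

/-- PROPOSED ITEM TEXT K2r0P♭ (the μ-free twin of K2r0P): the ten published inputs of K2r0P, THEN the FLAT text, THEN the body of
`SignedMainConjectureCMTwoRankZero` verbatim. -/
def SignedMainConjectureCMTwoRankZeroOfPubOfFlat : Prop :=
  Literature.NumberTheory.EllipticCurves.bsdTriple_of_hasCM_of_L_one_ne_zero →
  Literature.NumberTheory.EllipticCurves.ModularForms.nonempty_modularParametrizationData →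
  WeierstrassCurve.hasEntireLFunction_rat →
  Literature.NumberTheory.EllipticCurves.rank_eq_analyticRank_of_analyticRank_le_one →
  Literature.NumberTheory.EllipticCurves.realPeriodRat_eq_unit_mul_plusPeriod_two →
  Literature.NumberTheory.EllipticCurves.Greenberg1999.casselsSurjectivity_H1Sigma ℚ →
  Literature.NumberTheory.EllipticCurves.Greenberg1999.prop412_noFiniteSubmodule_H1Sigma_of_rank_one →
  Literature.NumberTheory.EllipticCurves.Greenberg1999.h1Sigma_zpCorank_le_degree ℚ →
  Literature.NumberTheory.EllipticCurves.Greenberg1999.localQuotient_restriction_surjective ℚ →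
  Literature.NumberTheory.EllipticCurves.Greenberg1999.h1SigmaInfty_rank_eq_one →
  AnalyticMuFlatCMTwoRankZero →
  ∀ (A : WeierstrassCurve ℚ) [A.IsElliptic] [A.IsGloballyMinimal], A.HasCM → A.analyticRank = 0 →
    Literature.NumberTheory.EllipticCurves.Rank1Residual.GoodSS A 2 → A.frobeniusTrace 2 = 0 →
    (∀ (κ : Literature.NumberTheory.EllipticCurves.ZpExtension ℚ 2) (γ : Field.absoluteGaloisGroup ℚ),
      κ.IsCyclotomic → κ.IsTopGenerator γ →
      ∀ D : Literature.NumberTheory.EllipticCurves.Kobayashi2003.SignedSelmerDualData A κ γ 1,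
        Module.IsTorsion (Literature.NumberTheory.EllipticCurves.IwasawaAlgebra 2) D.X ∧ D.mu = 0) ∧
    Summit.BirchSwinnertonDyer.Rank1Residual.Supersingular.KobayashiMainConjecture A 2 1

/-- (i) The port ALONE closes the μ-free twin: D_MC → K2r0P♭ (kernel; via the g7 turnkey + p597954). -/
theorem ofPubOfFlat_of_upToTwoPower (hD : SignedMainConjectureUpToTwoPowerCMTwoRankZero) :
    SignedMainConjectureCMTwoRankZeroOfPubOfFlat :=
  fun hBF hmod hLrat hGZK h2 hC h412 hcork hP108 hWL hμ A _ _ hcm hr hss ha ↦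
    Summit.BirchSwinnertonDyer.BirchSwinnertonDyer.Theorems.signedMainConjectureCMTwoRankZero_body_of_pub_of_upToTwoPower_of_flat
      hBF hmod hLrat hGZK h2 hC h412 hcork hP108 hWL
      (Summit.BirchSwinnertonDyer.BirchSwinnertonDyer.Theorems.signedUpToTwoPowerNonUnitCMTwo_of_exists hD) hμ A hcm hr hss ha

/-- (ii) The split is lossless: K2r0P♭ together with FLAT gives the route's K2r0P VERBATIM. -/
theorem k2r0p_of_flat_of_ofPubOfFlat (hμ : AnalyticMuFlatCMTwoRankZero) (h : SignedMainConjectureCMTwoRankZeroOfPubOfFlat) :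
    Summit.BirchSwinnertonDyer.BirchSwinnertonDyer.Theses.ThetaPartnerAtTwo.SignedMainConjectureCMTwoRankZeroOfPub :=
  fun hBF hmod hLrat hGZK h2 hC h412 hcork hP108 hWL A _ _ hcm hr hss ha ↦
    h hBF hmod hLrat hGZK h2 hC h412 hcork hP108 hWL hμ A hcm hr hss ha

/-- (iii) Conversely nothing is lost the other way: K2r0P implies K2r0P♭ trivially (drop the FLAT hypothesis). -/
theorem ofPubOfFlat_of_k2r0p (h : Summit.BirchSwinnertonDyer.BirchSwinnertonDyer.Theses.ThetaPartnerAtTwo.SignedMainConjectureCMTwoRankZeroOfPub) :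
    SignedMainConjectureCMTwoRankZeroOfPubOfFlat :=
  fun hBF hmod hLrat hGZK h2 hC h412 hcork hP108 hWL _ A _ _ hcm hr hss ha ↦
    h hBF hmod hLrat hGZK h2 hC h412 hcork hP108 hWL A hcm hr hss ha

/-! ## §2 (g8 FREEZE addendum) K2r0P♭ from the LENGTH currency: the single stub of the twin's skeleton may be stated as (MC-len)_A -/

/-- PROPOSED STUB TEXT (MC-len)_A for the K2r0P♭ skeleton (alternative to D_MC, same research content, K3 `lengthAt` currency — the natural end of
the Kato-route port (P1)–(P4)): one `ϖ`, one Pollack pair at `2`, every dual datum of `Sel⁺(A/ℚ_∞)` torsion with `ℓ_𝔭(X⁺) = ℓ_𝔭(Λ/(L♭))` at every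
height-one `𝔭 ∌ 2`. -/
def SignedMainConjectureLengthCMTwoRankZero : Prop :=
  ∀ (A : WeierstrassCurve ℚ) [A.IsElliptic] [A.IsGloballyMinimal],
    A.HasCM → A.analyticRank = 0 → GoodSS A 2 → A.frobeniusTrace 2 = 0 →
    2 ∣ A.shaOrder * A.tamagawaProduct →
    ∀ (κ : ZpExtension ℚ 2) (γ : Field.absoluteGaloisGroup ℚ),
      κ.IsCyclotomic → κ.IsTopGenerator γ → IsCyclotomicVariable 2 γ →
    ∀ [NeZero (A.conductorNorm ℤ)] (f : CuspForm (Gamma0 (A.conductorNorm ℤ)) 2), IsNewformOf A f →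
    ∃ (ϖ : ℚ) (Lplus Lminus : IwasawaAlgebra 2), (ϖ : ℝ) * A.realPeriodRat = plusPeriod f ∧
      IsPollackPair f 2 Lplus Lminus ∧
      ∀ (D : SignedSelmerDualData A κ γ 1), Module.IsTorsion (IwasawaAlgebra 2) D.X ∧
        ∀ 𝔭 : PrimeSpectrum (IwasawaAlgebra 2), 𝔭.asIdeal.height = 1 →
          PowerSeries.C (2 : ℤ_[2]) ∉ 𝔭.asIdeal →
          Literature.NumberTheory.EllipticCurves.Module.lengthAt (IwasawaAlgebra 2) D.X 𝔭 =
            Literature.NumberTheory.EllipticCurves.Module.lengthAt (IwasawaAlgebra 2)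
              (IwasawaAlgebra 2 ⧸ Ideal.span {kobayashiL 1 Lplus Lminus}) 𝔭

/-- (iv) (MC-len)_A ⇒ D_MC (kernel, p609811/p610219). -/
theorem upToTwoPower_of_length (h : SignedMainConjectureLengthCMTwoRankZero) : SignedMainConjectureUpToTwoPowerCMTwoRankZero :=
  Summit.BirchSwinnertonDyer.BirchSwinnertonDyer.Theorems.SignedLengthDoors.signedUpToTwoPowerNonUnitCMTwo_exists_of_lengthEq h

/-- (v) (MC-len)_A ALONE closes the μ-free twin K2r0P♭ (kernel): the closing file of a 1-stub skeleton on K2r0P♭ is this term. -/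
theorem ofPubOfFlat_of_length (h : SignedMainConjectureLengthCMTwoRankZero) : SignedMainConjectureCMTwoRankZeroOfPubOfFlat :=
  ofPubOfFlat_of_upToTwoPower (upToTwoPower_of_length h)

/-- (vi) … and with FLAT it gives the route's K2r0P VERBATIM. -/
theorem k2r0p_of_flat_of_length (hμ : AnalyticMuFlatCMTwoRankZero) (h : SignedMainConjectureLengthCMTwoRankZero) :
    Summit.BirchSwinnertonDyer.BirchSwinnertonDyer.Theses.ThetaPartnerAtTwo.SignedMainConjectureCMTwoRankZeroOfPub :=
  k2r0p_of_flat_of_ofPubOfFlat hμ (ofPubOfFlat_of_length h)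

end Summit.BirchSwinnertonDyer.BirchSwinnertonDyer.Cruxes.SignedMainConjectureCMTwoRankZeroOfPub.Cert

end
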